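import Summits.BirchSwinnertonDyer.Rank1Residual.GaloisImage.PrimeChoiceSakamoto
import Summits.BirchSwinnertonDyer.Rank1Residual.GaloisImage.InflationRestrictionSakamotoH3
import Summits.BirchSwinnertonDyer.Rank1Residual.GaloisImage.KolyvaginSystemsKummerVanishRat
import Literature.NumberTheory.EllipticCurves.NonEisensteinPrimeOfSurjective
import HarnessLib

/-!
# Sakamoto's prime choice for `T̄ = E[p]`, `ρ̄_{E,p}` onto, `p` odd: the binder `hC55` of
# `CoreRankZero.kummer_kolyvaginSystems_eq_bot_rat` DISCHARGED
# (cell `b2b-bsdres`, team n1011, row T-C55K, file 5/5 — the `E[p]` reading over `ℚ`; seat p15)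

HONEST FRAMING (cell `b2b-bsdres`, run/shared/lean/b2b/bsd-rank1-residual/, verbatim in every
file): the goal of the cell is to DELETE the COMBINATION-SHAPED residual classes of the
Birch–Swinnerton-Dyer formula for ALL analytic-rank `≤ 1` elliptic curves over `ℚ` — "full BSD
formula for every rank `≤ 1` curve in class `C`" assembled STRICTLY from published theorems — so
that the rank-`≤ 1` remainder becomes exactly the CONSTRUCTION-SHAPED classes, which are TYPED
(missing-input `Prop`s), NOT attempted. This is not "finishing BSD". Team n1011 (N10/N11, the
additive block `X4 ∧ p = 3`): research route; TOOL theorems, no class theorem, nothing booked, no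
mark changed; no definition, no named fact.

## What

File 4 (`PrimeChoiceSakamoto`) proves Sakamoto's Cor. 5.5 for any finite discrete module under the
tree shapes of (H.1) and (H.3).  For `E/ℚ`, an odd prime `p` and `ρ̄_{E,p} : Γ_ℚ → GL₂(𝔽_p)` ONTO,
both hypotheses are tree THEOREMS:
* (H.1) = `hasIrreducibleModPGaloisRep_of_hasSurjectiveModNGaloisRep` (its definition
  `HasIrreducibleModPGaloisRep` is literally "no `Γ_ℚ`-stable subgroup of `E[p]` other than `⊥, ⊤`");
* (H.3) = `hH3_self_of_hasSurjectiveModNGaloisRep` (n1011-p04, `InflationRestrictionSakamotoH3`: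
  Sah's lemma, `−1` central in the image).
Hence:
* `infinite_setOf_mem_frobeniusClassPrimes_localization_ne_zero_torsion` — for non-zero
  `c₁, c₂, c₃ ∈ H¹(ℚ, E[p])`, infinitely many `𝔮 ∈ frobeniusClassPrimes (E[p]) S τ p` have
  `loc_𝔮 cᵢ ≠ 0` (`i = 1, 2, 3`), for every finite `S` and every `τ` with `E[p]/(τ − 1) ≃ ℤ/p`;
* `hC55_of_hasSurjectiveModNGaloisRep` — the same on `D.primes` for a Kolyvagin datum with
  `D.primes = frobeniusClassPrimes (E[p]) {v | inr v ∈ S} τ p`: VERBATIM the hypothesis `hC55` of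
  n1011-p11's `CoreRankZero.kummer_kolyvaginSystems_eq_bot_rat` (R1-16 FILE 6), which is thereby
  a theorem WITHOUT that binder on every row with `ρ̄_{E,p}` onto — in particular on every N11 row
  (`p = 3`, surj(3)).  Backlog item TB-S24C55 ("type [S24] Cor. 5.5 as a cited fact") is not needed;
* `kummer_kolyvaginSystems_eq_bot_rat_of_hasSurjectiveModNGaloisRep` — the CONSUMER RE-RUN: p11's
  `CoreRankZero.kummer_kolyvaginSystems_eq_bot_rat` with the binder `hC55` REPLACED by
  `ρ̄_{E,p}` onto (partial application — this is the kernel check that the shapes match literally):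
  `KS₁(E[p], 𝓚, 𝒫(τ)) = 0` over `ℚ` modulo the Poitou–Tate family, `hEP`, `hS`/`h𝓚`, `hadm` only.

References: R. Sakamoto, *The theory of Kolyvagin systems for p = 3*, JTNB 36 (2024), Cor. 5.5
(p. 929); B. Mazur, K. Rubin, *Kolyvagin systems*, Mem. AMS 799 (2004), Prop. 3.6.1 and
Lemma 6.2.3 ((H.1)–(H.3) from surjectivity).
-/

noncomputable section

open scoped Classical NumberField ContRepresentation
open Function Field NumberField IsDedekindDomain WeierstrassCurve
open Literature.NumberTheory.EllipticCurves
open Literature.NumberTheory.GaloisRepresentations Literature.NumberTheory.GaloisRepresentations.DiscreteGaloisModule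
open Literature.NumberTheory.GaloisCohomology

namespace Summit.BirchSwinnertonDyer.Rank1Residual.GaloisImage.PrimeChoice

variable (W : WeierstrassCurve ℚ) [W.IsElliptic]

/-- **Sakamoto's Cor. 5.5 for `T̄ = E[p]`, `p` odd, `ρ̄_{E,p}` onto — THEOREM.**  For `E/ℚ`, an odd
prime `p` with `ρ̄_{E,p}` surjective, any finite set `S` of primes, any `τ ∈ Γ_ℚ` with
`E[p]/(τ − 1)E[p] ≃ ℤ/p`, and non-zero `c₁, c₂, c₃ ∈ H¹(ℚ, E[p])`: infinitely many
`𝔮 ∈ frobeniusClassPrimes (E[p]) S τ p` satisfy `loc_𝔮 c₁ ≠ 0 ∧ loc_𝔮 c₂ ≠ 0 ∧ loc_𝔮 c₃ ≠ 0`.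
(H.1) by `hasIrreducibleModPGaloisRep_of_hasSurjectiveModNGaloisRep`, (H.3) by
`hH3_self_of_hasSurjectiveModNGaloisRep`, the rest is file 4.
[cite: Sakamoto2024, Cor. 5.5 (p. 929)] [cite: MazurRubin2004, Prop. 3.6.1 and Lemma 6.2.3] -/
theorem infinite_setOf_mem_frobeniusClassPrimes_localization_ne_zero_torsion
    (p : ℕ) [Fact p.Prime] (hp2 : p ≠ 2) (hsurj : W.HasSurjectiveModNGaloisRep (p : ℤ))
    (S : Set (HeightOneSpectrum (𝓞 ℚ))) (hS : S.Finite) {τ : absoluteGaloisGroup ℚ}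
    (hτ : Nonempty (cokerSubOne (W.torsionGaloisModule (p : ℤ)) τ ≃+ ZMod p)) :
    ∀ c₁ c₂ c₃ : galoisCohomology (W.torsionGaloisModule (p : ℤ)) 1, c₁ ≠ 0 → c₂ ≠ 0 → c₃ ≠ 0 →
      {q ∈ frobeniusClassPrimes (W.torsionGaloisModule (p : ℤ)) S τ p |
        galoisCohomology.localization (W.torsionGaloisModule (p : ℤ)) (Sum.inr q) 1 c₁ ≠ 0 ∧
        galoisCohomology.localization (W.torsionGaloisModule (p : ℤ)) (Sum.inr q) 1 c₂ ≠ 0 ∧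
        galoisCohomology.localization (W.torsionGaloisModule (p : ℤ)) (Sum.inr q) 1 c₃ ≠ 0}.Infinite := by
  have hp : p.Prime := Fact.out
  haveI : NeZero (p : ℚ) := ⟨Nat.cast_ne_zero.mpr hp.ne_zero⟩
  haveI : Finite (geomTorsion W (p : ℤ)) :=
    finite_torsionPoints_holds W (AlgebraicClosure ℚ) (by exact_mod_cast hp.ne_zero)
  have hp3 : 3 ≤ p := by
    rcases hp.eq_two_or_odd' with h | h
    · exact absurd h hp2
    · have := hp.two_le; omega
  have hirr := hasIrreducibleModPGaloisRep_of_hasSurjectiveModNGaloisRep W p hsurj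
  exact infinite_setOf_mem_frobeniusClassPrimes_localization_ne_zero_three
    (W.torsionGaloisModule (p : ℤ)) hp3 hp.ne_zero S hS hτ
    (fun A hA => hirr A fun σ P hP => hA σ P hP)
    (fun f hf => hH3_self_of_hasSurjectiveModNGaloisRep W p hp2 hsurj f hf)

/-- **The binder `hC55` of `CoreRankZero.kummer_kolyvaginSystems_eq_bot_rat` (R1-16 FILE 6,
n1011-p11) DISCHARGED under `ρ̄_{E,p}` onto, `p` odd**: for a Kolyvagin datum `D` on `E[p]` whose
primes are Sakamoto's `𝒫(τ)` at level `p` off the finite set `S` of places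
(`D.primes = frobeniusClassPrimes (E[p]) {v | inr v ∈ S} τ p`, the consumer's `hP`) and `τ` with
`E[p]/(τ − 1) ≃ ℤ/p` (the consumer's `hτ`), every three non-zero classes of `H¹(ℚ, E[p])` are
simultaneously non-zero locally at infinitely many `𝔮 ∈ D.primes` — VERBATIM the hypothesis
`hC55` there (checked by the shape of the statement; partial application
`kummer_kolyvaginSystems_eq_bot_rat W p hp2 … hP hT hτ hτμ hadm (hC55_of_hasSurjectiveModNGaloisRep W p hp2 hsurj hP hτ)`).
[cite: Sakamoto2024, Cor. 5.5 (p. 929)] -/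
theorem hC55_of_hasSurjectiveModNGaloisRep (p : ℕ) [Fact p.Prime] (hp2 : p ≠ 2)
    (hsurj : W.HasSurjectiveModNGaloisRep (p : ℤ)) {S : Finset (Place ℚ)}
    {D : KolyvaginDatum (W.torsionGaloisModule (p : ℤ))} {τ : absoluteGaloisGroup ℚ}
    (hP : D.primes = frobeniusClassPrimes (W.torsionGaloisModule (p : ℤ))
      {v | (Sum.inr v : Place ℚ) ∈ S} τ p)
    (hτ : Nonempty (cokerSubOne (W.torsionGaloisModule (p : ℤ)) τ ≃+ ZMod p)) :
    ∀ c₁ c₂ c₃ : galoisCohomology (W.torsionGaloisModule (p : ℤ)) 1, c₁ ≠ 0 → c₂ ≠ 0 → c₃ ≠ 0 →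
      {q ∈ D.primes |
        galoisCohomology.localization (W.torsionGaloisModule (p : ℤ)) (Sum.inr q) 1 c₁ ≠ 0 ∧
        galoisCohomology.localization (W.torsionGaloisModule (p : ℤ)) (Sum.inr q) 1 c₂ ≠ 0 ∧
        galoisCohomology.localization (W.torsionGaloisModule (p : ℤ)) (Sum.inr q) 1 c₃ ≠ 0}.Infinite := by
  have hS : {v : HeightOneSpectrum (𝓞 ℚ) | (Sum.inr v : Place ℚ) ∈ S}.Finite :=
    (S.finite_toSet.preimage Sum.inr_injective.injOn)
  rw [hP]
  exact infinite_setOf_mem_frobeniusClassPrimes_localization_ne_zero_torsion W p hp2 hsurj _ hS hτ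

/-- **CONSUMER RE-RUN: `KS₁(E[p], 𝓚, 𝒫(τ)) = 0` over `ℚ` WITHOUT the prime-choice binder.**
n1011-p11's `CoreRankZero.kummer_kolyvaginSystems_eq_bot_rat` (R1-16 FILE 6: for `E/ℚ`, `p` odd,
the classical Kummer structure `𝓚` and a Kolyvagin datum on Sakamoto's `𝒫(τ)` with the cyclotomic
transverse conditions, the group of Kolyvagin systems `KS₁(E[p], 𝓚, 𝒫(τ))` vanishes — Mazur–Rubin
Thm. 4.2.2 / Rubin PCMI Thm. 2.7.6 at `m = 1`, `χ(𝓚) = 0`) with its hypothesis `hC55` ([S24]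
Cor. 5.5) SUPPLIED by `hC55_of_hasSurjectiveModNGaloisRep` from `ρ̄_{E,p}` onto.  Remaining
hypotheses, all as in p11's theorem: the Poitou–Tate family (`hperf`, `hsum`, `hcompl`), Tate's local
Euler characteristic `hEP`, the finite set `S` (`hS`, `h𝓚`), the datum (`hP`, `hT`, `hτ`, `hτμ`) and
admissibility `hadm`.  (The term is a partial application of p11's theorem — the kernel's check that
the discharged binder has LITERALLY the shape `hC55`.)
[cite: Sakamoto2024, Cor. 5.5 (p. 929)] [cite: Rubin2011, Thm. 2.7.6 (p. 24)] -/
theorem kummer_kolyvaginSystems_eq_bot_rat_of_hasSurjectiveModNGaloisRep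
    (p : ℕ) [Fact p.Prime] (hp2 : p ≠ 2) [Finite (geomTorsion W (p : ℤ))]
    (hsurj : W.HasSurjectiveModNGaloisRep (p : ℤ))
    {inv : LocalInvariants ℚ p}
    (hperf : inv.IsPerfect) (hsum : inv.SumLocalTermEqZero) (hcompl : inv.SelmerComplement)
    (hEP : ∀ v : HeightOneSpectrum (𝓞 ℚ), localEulerPoincareCharacteristic (v.adicCompletion ℚ))
    {S : Finset (Place ℚ)}
    (hS : ∀ v : HeightOneSpectrum (𝓞 ℚ), (Sum.inr v : Place ℚ) ∉ S →
      ((p : ℕ) : 𝓞 ℚ) ∉ v.asIdeal ∧ GaloisRep.IsUnramifiedAt v (W.torsionGaloisModule (p : ℤ)))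
    (h𝓚 : (W.kummerSelmerStructure (p : ℤ)).IsUnramifiedOutside S)
    {D : KolyvaginDatum (W.torsionGaloisModule (p : ℤ))} {τ : absoluteGaloisGroup ℚ}
    (hP : D.primes = frobeniusClassPrimes (W.torsionGaloisModule (p : ℤ))
      {v | (Sum.inr v : Place ℚ) ∈ S} τ p)
    (hT : D.transverse = cyclotomicTransverse (W.torsionGaloisModule (p : ℤ)))
    (hτ : Nonempty (cokerSubOne (W.torsionGaloisModule (p : ℤ)) τ ≃+ ZMod p))
    (hτμ : τ ∈ rootsOfUnityFixer ℚ p)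
    (hadm : D.IsAdmissible) :
    D.kolyvaginSystems (W.kummerSelmerStructure (p : ℤ)) = ⊥ :=
  CoreRankZero.kummer_kolyvaginSystems_eq_bot_rat W p hp2 hperf hsum hcompl hEP hS h𝓚 hP hT hτ hτμ
    hadm (hC55_of_hasSurjectiveModNGaloisRep W p hp2 hsurj hP hτ)

end Summit.BirchSwinnertonDyer.Rank1Residual.GaloisImage.PrimeChoice

end
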